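import Mathlib.Analysis.SpecialFunctions.Pow.Real
import Mathlib.Analysis.SpecialFunctions.Log.Basic
import Mathlib.Analysis.MeanInequalities
import Summits.CriticalPhenomena.PercolationContinuityZ3.Theorems.PercNearOneGluingNoHeavyLowerTailSuperTerminalQuarticOneSided
import HarnessLib

/-!
# The reduced two-piece lemma `(R6)` behind the parallel-composition stability of `V4`

Support file for crux `stmt-CriticalPhenomena-4575` (`NoHeavyLowerTail`), seat `prim-nh-lead-4575` lead gen 134 (`--supports stmt-CriticalPhenomena-4575`;
memo `run/shared/lean/prim/prim-nh-lead-4575/FROM-prim-nh-lead-4575-g134-V4-PARALLEL-CLOSURE.md`, §3).  No definitions, no sorries, standard axioms.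
Second of three files: `…SuperTerminalQuarticOneSided` (one-variable lemma) → this file → `…SuperTerminalQuarticStable` (cell level:
`[V4 ∧ (Q6)_c](piece 1) ∧ [V4 ∧ (Q6)_c](piece 2) ⟹ V4(composite)`).

Normalised variables of a 4-terminal piece (memo §3): `t = n/(n+σ)`, `a = U/(A+U)`, `b = W/(B+W)`, `Φ = √γ·(A+U)(B+W)/(n+σ)²`; the piece's `V4` reads
`(1-t)² ≤ Φ(1-a)(1-b)`, and `(Q6)_c` times the four cell products `UW ≥ n²`, `AB ≥ σ²`, `AW ≥ σn`, `UB ≥ σn` read `t² ≤ Φ⁴ab`, `(1-t)² ≤ Φ⁴(1-a)(1-b)`,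
`t(1-t) ≤ Φ⁴(1-a)b`, `t(1-t) ≤ Φ⁴a(1-b)`; the composite's `V4` (X-free form) reads `(1-t₁t₂)² ≤ (1-a₁a₂)(1-b₁b₂)Φ₁Φ₂` — this is `r6`.
* `opl` — the ONE-PIECE inequality `(1-t^k)² ≤ Φ^k(1-a^k)(1-b^k)` for every real `k ≥ 1` (product of two instances of the one-variable lemma:
  `perI3`/`perII` for `k ≤ 4` via `finish_le4`, `perIq`/`perIIq` for `k ≥ 4` via `finish_ge4`);
* `young_split` — Young + weighted AM–GM: `(1-x^{1/r})^r (1-y^{1/(1-r)})^{1-r} ≤ 1 - xy`;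
* `r6_main` — the open box: conjugate exponents `k₁ = log(t₁t₂)/log t₁`, `k₂ = log(t₁t₂)/log t₂` (so `t₁^{k₁} = t₂^{k₂} = t₁t₂`), `opl` twice, `assemble`;
* `r6` — the closed box (`one_le_Phi`: the four `Φ⁴`-bounds sum to `Φ ≥ 1`; degenerate `t_i ∈ {0,1}` by `r6_zero`/`r6_one`).
-/

namespace Summit.CriticalPhenomena.PercolationContinuityZ3.Theorems.SuperTerminalQuarticR6

open Real Set
open Summit.CriticalPhenomena.PercolationContinuityZ3.Theorems.SuperTerminalQuarticOneSided

/-! ## Per-variable bounds (ratios `X₁ = (1-t)/(1-a)`, `X₀ = t/a`) -/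

/-- `a ≥ t`: `1 - t^k ≤ X₁·(1 - a^k)`. [this work] -/
theorem perI {k t a : ℝ} (hk : 1 ≤ k) (ht : 0 < t) (hta : t ≤ a) (ha : a < 1) :
    1 - t ^ k ≤ (1 - t) / (1 - a) * (1 - a ^ k) := by
  have hc := chord_rpow hk ht.le hta ha
  have haa : 0 < 1 - a := by linarith
  rw [div_mul_eq_mul_div, le_div_iff₀ haa]
  linarith

/-- `a ≥ t`, `k ≥ 4`: `1 - t^k ≤ X₁^{k/4}·(1 - a^k)`. [this work] -/
theorem perIq {k t a : ℝ} (hk : 4 ≤ k) (ht : 0 < t) (hta : t ≤ a) (ha : a < 1) :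
    1 - t ^ k ≤ ((1 - t) / (1 - a)) ^ (k / 4) * (1 - a ^ k) := by
  have haa : 0 < 1 - a := by linarith
  have htt : 0 < 1 - t := by linarith
  have hI := regionI (k := k) (E := k / 4) (by linarith) (by linarith) ht.le hta ha
  rw [Real.div_rpow htt.le haa.le, div_mul_eq_mul_div, le_div_iff₀ (Real.rpow_pos_of_pos haa _)]
  linarith

/-- `a ≤ t`, `k > 0`: `1 - t^k ≤ X₀^{k/4}·(1 - a^k)` (both factors on the right dominate). [this work] -/
theorem perIIq {k t a : ℝ} (hk : 0 < k) (ha : 0 < a) (hat : a ≤ t) (ht : t < 1) :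
    1 - t ^ k ≤ (t / a) ^ (k / 4) * (1 - a ^ k) := by
  have h1 : a ^ k ≤ t ^ k := Real.rpow_le_rpow ha.le hat hk.le
  have h2 : 1 ≤ (t / a) ^ (k / 4) := Real.one_le_rpow ((one_le_div ha).2 hat) (by linarith)
  have h3 : t ^ k < 1 := Real.rpow_lt_one (ha.le.trans hat) ht hk
  nlinarith

/-- `a ≤ t`, `1 ≤ k ≤ 4`: `(1 - t^k)³ ≤ X₁^{4-k}·X₀^{k-1}·(1 - a^k)³` (= `regionII`). [this work] -/
theorem perII {k t a : ℝ} (hk1 : 1 ≤ k) (hk4 : k ≤ 4) (ha : 0 < a) (hat : a ≤ t) (ht : t < 1) :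
    (1 - t ^ k) ^ 3 ≤ ((1 - t) / (1 - a)) ^ (4 - k) * (t / a) ^ (k - 1) * (1 - a ^ k) ^ 3 := by
  have hII := regionII hk1 hk4 ha hat ht
  have haa : 0 < 1 - a := by linarith
  have htt : 0 < 1 - t := by linarith
  have ht0 : 0 < t := ha.trans_le hat
  have hD : 0 < (1 - a) ^ (4 - k) * a ^ (k - 1) := by positivity
  rw [Real.div_rpow htt.le haa.le, Real.div_rpow ht0.le ha.le, div_mul_div_comm, div_mul_eq_mul_div, le_div_iff₀ hD]
  calc (1 - t ^ k) ^ 3 * ((1 - a) ^ (4 - k) * a ^ (k - 1)) = (1 - t ^ k) ^ 3 * (a ^ (k - 1) * (1 - a) ^ (4 - k)) := by ring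
    _ ≤ (1 - a ^ k) ^ 3 * (t ^ (k - 1) * (1 - t) ^ (4 - k)) := hII
    _ = (1 - t) ^ (4 - k) * t ^ (k - 1) * (1 - a ^ k) ^ 3 := by ring

/-- `a ≥ t`, `1 ≤ k ≤ 4`: `(1 - t^k)³ ≤ X₁^{4-k}·X₁^{k-1}·(1 - a^k)³`. [this work] -/
theorem perI3 {k t a : ℝ} (hk1 : 1 ≤ k) (ht : 0 < t) (hta : t ≤ a) (ha : a < 1) :
    (1 - t ^ k) ^ 3 ≤ ((1 - t) / (1 - a)) ^ (4 - k) * ((1 - t) / (1 - a)) ^ (k - 1) * (1 - a ^ k) ^ 3 := by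
  have hX : 0 < (1 - t) / (1 - a) := div_pos (by linarith) (by linarith)
  have h := perI hk1 ht hta ha
  have htk : t ^ k ≤ 1 := Real.rpow_le_one ht.le (by linarith) (by linarith)
  have e : ((1 - t) / (1 - a)) ^ (4 - k) * ((1 - t) / (1 - a)) ^ (k - 1) = ((1 - t) / (1 - a)) ^ 3 := by
    rw [← Real.rpow_add hX]; norm_num
  rw [e]
  calc (1 - t ^ k) ^ 3 ≤ ((1 - t) / (1 - a) * (1 - a ^ k)) ^ 3 := pow_le_pow_left₀ (by linarith) h 3
    _ = ((1 - t) / (1 - a)) ^ 3 * (1 - a ^ k) ^ 3 := by ring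


/-! ## The one-piece inequality -/

/-- Assembly for `1 ≤ k ≤ 4`: from the two cubed per-variable bounds and the two `Φ`-bounds. [this work] -/
theorem finish_le4 {k Φ X₁ Y₁ XA YB A B T : ℝ} (hk1 : 1 ≤ k) (hk4 : k ≤ 4) (hΦ : 0 < Φ)
    (hX₁ : 0 < X₁) (hY₁ : 0 < Y₁) (hXA : 0 < XA) (hYB : 0 < YB) (hT : 0 ≤ T) (hA : 0 ≤ A) (hB : 0 ≤ B)
    (hA3 : T ^ 3 ≤ X₁ ^ (4 - k) * XA ^ (k - 1) * A ^ 3) (hB3 : T ^ 3 ≤ Y₁ ^ (4 - k) * YB ^ (k - 1) * B ^ 3)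
    (h1 : X₁ * Y₁ ≤ Φ) (hP : XA * YB ≤ Φ ^ 4) :
    T ^ 2 ≤ Φ ^ k * (A * B) := by
  have hR : 0 ≤ Φ ^ k * (A * B) := by positivity
  rw [← pow_le_pow_iff_left₀ (by positivity) hR (by norm_num : (3:ℕ) ≠ 0)]
  have e1 : (X₁ * Y₁) ^ (4 - k) = X₁ ^ (4 - k) * Y₁ ^ (4 - k) := Real.mul_rpow hX₁.le hY₁.le
  have e2 : (XA * YB) ^ (k - 1) = XA ^ (k - 1) * YB ^ (k - 1) := Real.mul_rpow hXA.le hYB.le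
  have i1 : (X₁ * Y₁) ^ (4 - k) ≤ Φ ^ (4 - k) := Real.rpow_le_rpow (by positivity) h1 (by linarith)
  have i2 : (XA * YB) ^ (k - 1) ≤ (Φ ^ 4) ^ (k - 1) := Real.rpow_le_rpow (by positivity) hP (by linarith)
  have e3 : Φ ^ (4 - k) * (Φ ^ 4) ^ (k - 1) = (Φ ^ k) ^ 3 := by
    rw [← Real.rpow_natCast Φ 4, ← Real.rpow_mul hΦ.le, ← Real.rpow_add hΦ, ← Real.rpow_natCast (Φ ^ k) 3,
      ← Real.rpow_mul hΦ.le]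
    norm_num; ring_nf
  have hAB3 : 0 ≤ (A * B) ^ 3 := by positivity
  calc (T ^ 2) ^ 3 = T ^ 3 * T ^ 3 := by ring
    _ ≤ (X₁ ^ (4 - k) * XA ^ (k - 1) * A ^ 3) * (Y₁ ^ (4 - k) * YB ^ (k - 1) * B ^ 3) :=
        mul_le_mul hA3 hB3 (by positivity) (by positivity)
    _ = ((X₁ * Y₁) ^ (4 - k) * (XA * YB) ^ (k - 1)) * (A * B) ^ 3 := by rw [e1, e2]; ring
    _ ≤ (Φ ^ (4 - k) * (Φ ^ 4) ^ (k - 1)) * (A * B) ^ 3 :=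
        mul_le_mul_of_nonneg_right (mul_le_mul i1 i2 (by positivity) (by positivity)) hAB3
    _ = (Φ ^ k * (A * B)) ^ 3 := by rw [e3]; ring

/-- Assembly for `k ≥ 4` (any `k ≥ 0`): from the two per-variable bounds with exponent `k/4` and one `Φ⁴`-bound. [this work] -/
theorem finish_ge4 {k Φ XA YB A B T : ℝ} (hk : 0 ≤ k) (hΦ : 0 < Φ) (hXA : 0 < XA) (hYB : 0 < YB) (hT : 0 ≤ T)
    (hA : 0 ≤ A) (hB : 0 ≤ B)
    (hA1 : T ≤ XA ^ (k / 4) * A) (hB1 : T ≤ YB ^ (k / 4) * B) (hP : XA * YB ≤ Φ ^ 4) :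
    T ^ 2 ≤ Φ ^ k * (A * B) := by
  have e2 : (XA * YB) ^ (k / 4) = XA ^ (k / 4) * YB ^ (k / 4) := Real.mul_rpow hXA.le hYB.le
  have e3 : (Φ ^ 4) ^ (k / 4) = Φ ^ k := by
    rw [← Real.rpow_natCast Φ 4, ← Real.rpow_mul hΦ.le]; norm_num
    rw [mul_div_cancel₀ k (by norm_num : (4:ℝ) ≠ 0)]
  have i2 : (XA * YB) ^ (k / 4) ≤ (Φ ^ 4) ^ (k / 4) :=
    Real.rpow_le_rpow (by positivity) hP (div_nonneg hk (by norm_num))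
  calc T ^ 2 = T * T := by ring
    _ ≤ (XA ^ (k / 4) * A) * (YB ^ (k / 4) * B) := mul_le_mul hA1 hB1 hT (le_trans hT hA1)
    _ = (XA * YB) ^ (k / 4) * (A * B) := by rw [e2]; ring
    _ ≤ (Φ ^ 4) ^ (k / 4) * (A * B) := mul_le_mul_of_nonneg_right i2 (mul_nonneg hA hB)
    _ = Φ ^ k * (A * B) := by rw [e3]

/-- **The one-piece inequality.**  For `t, a, b ∈ (0,1)`, `Φ > 0` with `(1-t)² ≤ Φ(1-a)(1-b)` (`V4`) and
`t² ≤ Φ⁴ab`, `(1-t)² ≤ Φ⁴(1-a)(1-b)`, `t(1-t) ≤ Φ⁴(1-a)b`, `t(1-t) ≤ Φ⁴a(1-b)` (`(Q6)_c` × the four cell products), and every real `k ≥ 1`: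
`(1 - t^k)² ≤ Φ^k (1 - a^k)(1 - b^k)`. [this work] -/
theorem opl {k t a b Φ : ℝ} (hk : 1 ≤ k) (ht0 : 0 < t) (ht1 : t < 1) (ha0 : 0 < a) (ha1 : a < 1)
    (hb0 : 0 < b) (hb1 : b < 1) (hΦ : 0 < Φ)
    (h1 : (1 - t) ^ 2 ≤ Φ * ((1 - a) * (1 - b)))
    (h2 : t ^ 2 ≤ Φ ^ 4 * (a * b)) (h3 : (1 - t) ^ 2 ≤ Φ ^ 4 * ((1 - a) * (1 - b)))
    (h4 : t * (1 - t) ≤ Φ ^ 4 * ((1 - a) * b)) (h5 : t * (1 - t) ≤ Φ ^ 4 * (a * (1 - b))) :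
    (1 - t ^ k) ^ 2 ≤ Φ ^ k * ((1 - a ^ k) * (1 - b ^ k)) := by
  have hk0 : 0 < k := by linarith
  -- the four ratios
  have hta' : 0 < 1 - t := by linarith
  have haa' : 0 < 1 - a := by linarith
  have hbb' : 0 < 1 - b := by linarith
  have hX₁ : 0 < (1 - t) / (1 - a) := div_pos hta' haa'
  have hY₁ : 0 < (1 - t) / (1 - b) := div_pos hta' hbb'
  have hX₀ : 0 < t / a := div_pos ht0 ha0
  have hY₀ : 0 < t / b := div_pos ht0 hb0
  have r1 : (1 - t) / (1 - a) * ((1 - t) / (1 - b)) ≤ Φ := by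
    rw [div_mul_div_comm, div_le_iff₀ (by positivity)]; nlinarith
  have r11 : (1 - t) / (1 - a) * ((1 - t) / (1 - b)) ≤ Φ ^ 4 := by
    rw [div_mul_div_comm, div_le_iff₀ (by positivity)]; nlinarith
  have r00 : t / a * (t / b) ≤ Φ ^ 4 := by
    rw [div_mul_div_comm, div_le_iff₀ (by positivity)]; nlinarith
  have r10 : (1 - t) / (1 - a) * (t / b) ≤ Φ ^ 4 := by
    rw [div_mul_div_comm, div_le_iff₀ (by positivity)]; nlinarith
  have r01 : t / a * ((1 - t) / (1 - b)) ≤ Φ ^ 4 := by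
    rw [div_mul_div_comm, div_le_iff₀ (by positivity)]; nlinarith
  have hT : 0 ≤ 1 - t ^ k := by
    have := Real.rpow_lt_one ht0.le ht1 hk0; linarith
  have hA : 0 ≤ 1 - a ^ k := by
    have := Real.rpow_lt_one ha0.le ha1 hk0; linarith
  have hB : 0 ≤ 1 - b ^ k := by
    have := Real.rpow_lt_one hb0.le hb1 hk0; linarith
  rcases le_total k 4 with hk4 | hk4
  · -- `1 ≤ k ≤ 4`: cubed per-variable bounds
    rcases le_total t a with hta | hat <;> rcases le_total t b with htb | hbt
    · exact finish_le4 hk hk4 hΦ hX₁ hY₁ hX₁ hY₁ hT hA hB (perI3 hk ht0 hta ha1) (perI3 hk ht0 htb hb1) r1 r11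
    · exact finish_le4 hk hk4 hΦ hX₁ hY₁ hX₁ hY₀ hT hA hB (perI3 hk ht0 hta ha1) (perII hk hk4 hb0 hbt ht1) r1 r10
    · exact finish_le4 hk hk4 hΦ hX₁ hY₁ hX₀ hY₁ hT hA hB (perII hk hk4 ha0 hat ht1) (perI3 hk ht0 htb hb1) r1 r01
    · exact finish_le4 hk hk4 hΦ hX₁ hY₁ hX₀ hY₀ hT hA hB (perII hk hk4 ha0 hat ht1) (perII hk hk4 hb0 hbt ht1) r1 r00
  · -- `k ≥ 4`: exponent `k/4`
    rcases le_total t a with hta | hat <;> rcases le_total t b with htb | hbt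
    · exact finish_ge4 hk0.le hΦ hX₁ hY₁ hT hA hB (perIq hk4 ht0 hta ha1) (perIq hk4 ht0 htb hb1) r11
    · exact finish_ge4 hk0.le hΦ hX₁ hY₀ hT hA hB (perIq hk4 ht0 hta ha1) (perIIq hk0 hb0 hbt ht1) r10
    · exact finish_ge4 hk0.le hΦ hX₀ hY₁ hT hA hB (perIIq hk0 ha0 hat ht1) (perIq hk4 ht0 htb hb1) r01
    · exact finish_ge4 hk0.le hΦ hX₀ hY₀ hT hA hB (perIIq hk0 ha0 hat ht1) (perIIq hk0 hb0 hbt ht1) r00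

/-! ## The reduced two-piece lemma `(R6)` -/

/-- Young + weighted AM–GM: for `0 < r < 1` and `x, y ∈ (0,1)`: `(1 - x^{1/r})^r (1 - y^{1/(1-r)})^{1-r} ≤ 1 - xy`. [folklore] -/
theorem young_split {r x y : ℝ} (hr0 : 0 < r) (hr1 : r < 1) (hx : 0 < x) (hx1 : x < 1) (hy : 0 < y) (hy1 : y < 1) :
    (1 - x ^ r⁻¹) ^ r * (1 - y ^ (1 - r)⁻¹) ^ (1 - r) ≤ 1 - x * y := by
  have hs0 : 0 < 1 - r := by linarith
  have hk : r⁻¹.HolderConjugate (1 - r)⁻¹ := Real.HolderConjugate.inv_one_sub_inv hr0 hr1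
  have hX : 0 ≤ 1 - x ^ r⁻¹ := by
    have := Real.rpow_lt_one hx.le hx1 (by positivity : (0:ℝ) < r⁻¹); linarith
  have hY' : 0 ≤ 1 - y ^ (1 - r)⁻¹ := by
    have := Real.rpow_lt_one hy.le hy1 (by positivity : (0:ℝ) < (1 - r)⁻¹); linarith
  have hY := Real.young_inequality_of_nonneg hx.le hy.le hk
  rw [div_inv_eq_mul, div_inv_eq_mul] at hY
  have hG := Real.geom_mean_le_arith_mean2_weighted hr0.le hs0.le hX hY' (by ring)
  linarith

/-- Abstract assembly of `(R6)` from the two one-piece inequalities and the two Young splits. [this work] -/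
theorem assemble {r T Φ₁ Φ₂ A₁ A₂ B₁ B₂ PA PB : ℝ} (hr0 : 0 < r) (hr1 : r < 1) (hT : 0 < T)
    (hΦ₁ : 0 < Φ₁) (hΦ₂ : 0 < Φ₂) (hA₁ : 0 ≤ A₁) (hA₂ : 0 ≤ A₂) (hB₁ : 0 ≤ B₁) (hB₂ : 0 ≤ B₂)
    (O₁ : T ≤ Φ₁ ^ r⁻¹ * (A₁ * B₁)) (O₂ : T ≤ Φ₂ ^ (1 - r)⁻¹ * (A₂ * B₂))
    (YA : A₁ ^ r * A₂ ^ (1 - r) ≤ PA) (YB : B₁ ^ r * B₂ ^ (1 - r) ≤ PB) :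
    T ≤ PA * PB * (Φ₁ * Φ₂) := by
  have hs0 : 0 < 1 - r := by linarith
  have split : T = T ^ r * T ^ (1 - r) := by
    rw [← Real.rpow_add hT]; norm_num
  have R₁ : T ^ r ≤ (Φ₁ ^ r⁻¹ * (A₁ * B₁)) ^ r := Real.rpow_le_rpow hT.le O₁ hr0.le
  have R₂ : T ^ (1 - r) ≤ (Φ₂ ^ (1 - r)⁻¹ * (A₂ * B₂)) ^ (1 - r) := Real.rpow_le_rpow hT.le O₂ hs0.le
  have E₁ : (Φ₁ ^ r⁻¹ * (A₁ * B₁)) ^ r = Φ₁ * (A₁ ^ r * B₁ ^ r) := by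
    rw [Real.mul_rpow (by positivity) (mul_nonneg hA₁ hB₁), Real.mul_rpow hA₁ hB₁, ← Real.rpow_mul hΦ₁.le,
      inv_mul_cancel₀ hr0.ne', Real.rpow_one]
  have E₂ : (Φ₂ ^ (1 - r)⁻¹ * (A₂ * B₂)) ^ (1 - r) = Φ₂ * (A₂ ^ (1 - r) * B₂ ^ (1 - r)) := by
    rw [Real.mul_rpow (by positivity) (mul_nonneg hA₂ hB₂), Real.mul_rpow hA₂ hB₂, ← Real.rpow_mul hΦ₂.le,
      inv_mul_cancel₀ hs0.ne', Real.rpow_one]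
  rw [E₁] at R₁
  rw [E₂] at R₂
  have hPA' : 0 ≤ A₁ ^ r * A₂ ^ (1 - r) := by positivity
  have hPB' : 0 ≤ B₁ ^ r * B₂ ^ (1 - r) := by positivity
  have hPA : 0 ≤ PA := le_trans hPA' YA
  calc T = T ^ r * T ^ (1 - r) := split
    _ ≤ (Φ₁ * (A₁ ^ r * B₁ ^ r)) * (Φ₂ * (A₂ ^ (1 - r) * B₂ ^ (1 - r))) :=
        mul_le_mul R₁ R₂ (Real.rpow_nonneg hT.le _) (by positivity)
    _ = (A₁ ^ r * A₂ ^ (1 - r)) * (B₁ ^ r * B₂ ^ (1 - r)) * (Φ₁ * Φ₂) := by ring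
    _ ≤ PA * PB * (Φ₁ * Φ₂) :=
        mul_le_mul_of_nonneg_right (mul_le_mul YA YB hPB' hPA) (by positivity)

/-- **`(R6)`, main case** (all of `t_i, a_i, b_i ∈ (0,1)`, `Φ_i > 0`).  Young's inequality with the conjugate exponents
`k₁ = log(t₁t₂)/log t₁`, `k₂ = log(t₁t₂)/log t₂` (so `t₁^{k₁} = t₂^{k₂} = t₁t₂`) splits `1 - a₁a₂ ≥ (1-a₁^{k₁})^{1/k₁}(1-a₂^{k₂})^{1/k₂}`
(and the same for `b`); the rest is `opl` for each piece. [this work] -/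
theorem r6_main {t₁ a₁ b₁ Φ₁ t₂ a₂ b₂ Φ₂ : ℝ}
    (ht₁ : 0 < t₁) (ht₁' : t₁ < 1) (ha₁ : 0 < a₁) (ha₁' : a₁ < 1) (hb₁ : 0 < b₁) (hb₁' : b₁ < 1) (hΦ₁ : 0 < Φ₁)
    (h1₁ : (1 - t₁) ^ 2 ≤ Φ₁ * ((1 - a₁) * (1 - b₁)))
    (h2₁ : t₁ ^ 2 ≤ Φ₁ ^ 4 * (a₁ * b₁)) (h3₁ : (1 - t₁) ^ 2 ≤ Φ₁ ^ 4 * ((1 - a₁) * (1 - b₁)))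
    (h4₁ : t₁ * (1 - t₁) ≤ Φ₁ ^ 4 * ((1 - a₁) * b₁)) (h5₁ : t₁ * (1 - t₁) ≤ Φ₁ ^ 4 * (a₁ * (1 - b₁)))
    (ht₂ : 0 < t₂) (ht₂' : t₂ < 1) (ha₂ : 0 < a₂) (ha₂' : a₂ < 1) (hb₂ : 0 < b₂) (hb₂' : b₂ < 1) (hΦ₂ : 0 < Φ₂)
    (h1₂ : (1 - t₂) ^ 2 ≤ Φ₂ * ((1 - a₂) * (1 - b₂)))
    (h2₂ : t₂ ^ 2 ≤ Φ₂ ^ 4 * (a₂ * b₂)) (h3₂ : (1 - t₂) ^ 2 ≤ Φ₂ ^ 4 * ((1 - a₂) * (1 - b₂)))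
    (h4₂ : t₂ * (1 - t₂) ≤ Φ₂ ^ 4 * ((1 - a₂) * b₂)) (h5₂ : t₂ * (1 - t₂) ≤ Φ₂ ^ 4 * (a₂ * (1 - b₂))) :
    (1 - t₁ * t₂) ^ 2 ≤ (1 - a₁ * a₂) * (1 - b₁ * b₂) * (Φ₁ * Φ₂) := by
  -- the exponents
  have hl₁ : Real.log t₁ < 0 := Real.log_neg ht₁ ht₁'
  have hl₂ : Real.log t₂ < 0 := Real.log_neg ht₂ ht₂'
  obtain ⟨L, hLdef⟩ : ∃ L, L = Real.log t₁ + Real.log t₂ := ⟨_, rfl⟩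
  have hL : L < 0 := by rw [hLdef]; linarith
  have hLne : L ≠ 0 := hL.ne
  have hLlog : Real.log (t₁ * t₂) = L := by rw [hLdef]; exact Real.log_mul ht₁.ne' ht₂.ne'
  obtain ⟨r, hrdef⟩ : ∃ r, r = Real.log t₁ / L := ⟨_, rfl⟩
  have hr0 : 0 < r := by rw [hrdef]; exact div_pos_of_neg_of_neg hl₁ hL
  have hr1 : r < 1 := by rw [hrdef, div_lt_iff_of_neg hL]; linarith
  have hs0 : 0 < 1 - r := by linarith
  have h1r : 1 - r = Real.log t₂ / L := by
    rw [hrdef, eq_div_iff hLne, sub_mul, div_mul_cancel₀ _ hLne, one_mul, hLdef]; ring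
  have hk₁ : 1 ≤ r⁻¹ := (one_le_inv₀ hr0).2 hr1.le
  have hk₂ : 1 ≤ (1 - r)⁻¹ := (one_le_inv₀ hs0).2 (by linarith)
  have htt : 0 < t₁ * t₂ := mul_pos ht₁ ht₂
  -- `t₁ ^ k₁ = t₁ t₂ = t₂ ^ k₂`
  have e₁ : t₁ ^ r⁻¹ = t₁ * t₂ := by
    rw [Real.rpow_def_of_pos ht₁, hrdef, inv_div, mul_div_cancel₀ L hl₁.ne, ← hLlog, Real.exp_log htt]
  have e₂ : t₂ ^ (1 - r)⁻¹ = t₁ * t₂ := by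
    rw [Real.rpow_def_of_pos ht₂, h1r, inv_div, mul_div_cancel₀ L hl₂.ne, ← hLlog, Real.exp_log htt]
  -- one-piece inequalities
  have O₁ := opl hk₁ ht₁ ht₁' ha₁ ha₁' hb₁ hb₁' hΦ₁ h1₁ h2₁ h3₁ h4₁ h5₁
  have O₂ := opl hk₂ ht₂ ht₂' ha₂ ha₂' hb₂ hb₂' hΦ₂ h1₂ h2₂ h3₂ h4₂ h5₂
  rw [e₁] at O₁
  rw [e₂] at O₂
  -- nonnegativity of the pieces
  have hpow1 : ∀ {x : ℝ}, 0 < x → x < 1 → 0 ≤ 1 - x ^ r⁻¹ := fun hx hx1 => by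
    have := Real.rpow_lt_one hx.le hx1 (by positivity : (0:ℝ) < r⁻¹); linarith
  have hpow2 : ∀ {x : ℝ}, 0 < x → x < 1 → 0 ≤ 1 - x ^ (1 - r)⁻¹ := fun hx hx1 => by
    have := Real.rpow_lt_one hx.le hx1 (by positivity : (0:ℝ) < (1 - r)⁻¹); linarith
  have hT : 0 < (1 - t₁ * t₂) ^ 2 := by
    have : t₁ * t₂ < 1 := mul_lt_one_of_nonneg_of_lt_one_left ht₁.le ht₁' ht₂'.le
    have : 0 < 1 - t₁ * t₂ := by linarith
    positivity
  exact assemble hr0 hr1 hT hΦ₁ hΦ₂ (hpow1 ha₁ ha₁') (hpow2 ha₂ ha₂') (hpow1 hb₁ hb₁') (hpow2 hb₂ hb₂')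
    O₁ O₂ (young_split hr0 hr1 ha₁ ha₁' ha₂ ha₂') (young_split hr0 hr1 hb₁ hb₁' hb₂ hb₂')

/-- From the four `Φ⁴`-bounds: `Φ ≥ 1` (their sum is `1 ≤ Φ⁴`). [this work] -/
theorem one_le_Phi {t a b Φ : ℝ} (hΦ : 0 ≤ Φ)
    (h2 : t ^ 2 ≤ Φ ^ 4 * (a * b)) (h3 : (1 - t) ^ 2 ≤ Φ ^ 4 * ((1 - a) * (1 - b)))
    (h4 : t * (1 - t) ≤ Φ ^ 4 * ((1 - a) * b)) (h5 : t * (1 - t) ≤ Φ ^ 4 * (a * (1 - b))) : 1 ≤ Φ := by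
  have h4' : 1 ≤ Φ ^ 4 := by nlinarith
  by_contra h
  rw [not_le] at h
  have : Φ ^ 4 < 1 := pow_lt_one₀ hΦ h (by norm_num)
  linarith

/-- Degenerate case `t₁ = 0` of `(R6)`. [this work] -/
theorem r6_zero {a₁ b₁ Φ₁ a₂ b₂ Φ₂ : ℝ} (ha₁ : 0 ≤ a₁) (ha₂ : a₂ ≤ 1) (hb₁ : 0 ≤ b₁) (hb₂ : b₂ ≤ 1)
    (ha₁' : a₁ ≤ 1) (hb₁' : b₁ ≤ 1) (hΦ₁ : 0 ≤ Φ₁) (hΦ₂ : 1 ≤ Φ₂)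
    (h : 1 ≤ Φ₁ * ((1 - a₁) * (1 - b₁))) : 1 ≤ (1 - a₁ * a₂) * (1 - b₁ * b₂) * (Φ₁ * Φ₂) := by
  have i1 : 1 - a₁ ≤ 1 - a₁ * a₂ := by nlinarith
  have i2 : 1 - b₁ ≤ 1 - b₁ * b₂ := by nlinarith
  have i12 : (1 - a₁) * (1 - b₁) ≤ (1 - a₁ * a₂) * (1 - b₁ * b₂) := mul_le_mul i1 i2 (by linarith) (by linarith)
  have step : Φ₁ * ((1 - a₁) * (1 - b₁)) ≤ (1 - a₁ * a₂) * (1 - b₁ * b₂) * Φ₁ := by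
    nlinarith [mul_le_mul_of_nonneg_left i12 hΦ₁]
  have hnn : 0 ≤ (1 - a₁ * a₂) * (1 - b₁ * b₂) * Φ₁ := le_trans (le_trans zero_le_one h) step
  calc (1:ℝ) ≤ (1 - a₁ * a₂) * (1 - b₁ * b₂) * Φ₁ * 1 := by linarith
    _ ≤ (1 - a₁ * a₂) * (1 - b₁ * b₂) * Φ₁ * Φ₂ := mul_le_mul_of_nonneg_left hΦ₂ hnn
    _ = (1 - a₁ * a₂) * (1 - b₁ * b₂) * (Φ₁ * Φ₂) := by ring

/-- Degenerate case `t₁ = 1` of `(R6)`. [this work] -/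
theorem r6_one {t₂ a₁ b₁ Φ₁ a₂ b₂ Φ₂ : ℝ} (ha₁ : a₁ ≤ 1) (ha₂ : 0 ≤ a₂) (hb₁ : b₁ ≤ 1) (hb₂ : 0 ≤ b₂)
    (ha₂' : a₂ ≤ 1) (hb₂' : b₂ ≤ 1) (hΦ₁ : 1 ≤ Φ₁) (hΦ₂ : 0 ≤ Φ₂)
    (h : (1 - t₂) ^ 2 ≤ Φ₂ * ((1 - a₂) * (1 - b₂))) :
    (1 - t₂) ^ 2 ≤ (1 - a₁ * a₂) * (1 - b₁ * b₂) * (Φ₁ * Φ₂) := by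
  have i1 : 1 - a₂ ≤ 1 - a₁ * a₂ := by nlinarith
  have i2 : 1 - b₂ ≤ 1 - b₁ * b₂ := by nlinarith
  have i12 : (1 - a₂) * (1 - b₂) ≤ (1 - a₁ * a₂) * (1 - b₁ * b₂) := mul_le_mul i1 i2 (by linarith) (by linarith)
  have step : Φ₂ * ((1 - a₂) * (1 - b₂)) ≤ (1 - a₁ * a₂) * (1 - b₁ * b₂) * Φ₂ := by
    nlinarith [mul_le_mul_of_nonneg_left i12 hΦ₂]
  have hnn : 0 ≤ (1 - a₁ * a₂) * (1 - b₁ * b₂) * Φ₂ := le_trans (le_trans (sq_nonneg _) h) step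
  calc (1 - t₂) ^ 2 ≤ (1 - a₁ * a₂) * (1 - b₁ * b₂) * Φ₂ * 1 := by linarith
    _ ≤ (1 - a₁ * a₂) * (1 - b₁ * b₂) * Φ₂ * Φ₁ := mul_le_mul_of_nonneg_left hΦ₁ hnn
    _ = (1 - a₁ * a₂) * (1 - b₁ * b₂) * (Φ₁ * Φ₂) := by ring

/-- **`(R6)` on the closed box.**  For `t_i, a_i, b_i ∈ [0,1]`, `Φ_i ≥ 0` (i = 1,2) with `(1-t)² ≤ Φ(1-a)(1-b)` and the four
`Φ⁴`-bounds: `(1 - t₁t₂)² ≤ (1 - a₁a₂)(1 - b₁b₂)Φ₁Φ₂`. [this work] -/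
theorem r6 {t₁ a₁ b₁ Φ₁ t₂ a₂ b₂ Φ₂ : ℝ}
    (ht₁ : 0 ≤ t₁) (ht₁' : t₁ ≤ 1) (ha₁ : 0 ≤ a₁) (ha₁' : a₁ ≤ 1) (hb₁ : 0 ≤ b₁) (hb₁' : b₁ ≤ 1) (hΦ₁ : 0 ≤ Φ₁)
    (h1₁ : (1 - t₁) ^ 2 ≤ Φ₁ * ((1 - a₁) * (1 - b₁)))
    (h2₁ : t₁ ^ 2 ≤ Φ₁ ^ 4 * (a₁ * b₁)) (h3₁ : (1 - t₁) ^ 2 ≤ Φ₁ ^ 4 * ((1 - a₁) * (1 - b₁)))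
    (h4₁ : t₁ * (1 - t₁) ≤ Φ₁ ^ 4 * ((1 - a₁) * b₁)) (h5₁ : t₁ * (1 - t₁) ≤ Φ₁ ^ 4 * (a₁ * (1 - b₁)))
    (ht₂ : 0 ≤ t₂) (ht₂' : t₂ ≤ 1) (ha₂ : 0 ≤ a₂) (ha₂' : a₂ ≤ 1) (hb₂ : 0 ≤ b₂) (hb₂' : b₂ ≤ 1) (hΦ₂ : 0 ≤ Φ₂)
    (h1₂ : (1 - t₂) ^ 2 ≤ Φ₂ * ((1 - a₂) * (1 - b₂)))
    (h2₂ : t₂ ^ 2 ≤ Φ₂ ^ 4 * (a₂ * b₂)) (h3₂ : (1 - t₂) ^ 2 ≤ Φ₂ ^ 4 * ((1 - a₂) * (1 - b₂)))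
    (h4₂ : t₂ * (1 - t₂) ≤ Φ₂ ^ 4 * ((1 - a₂) * b₂)) (h5₂ : t₂ * (1 - t₂) ≤ Φ₂ ^ 4 * (a₂ * (1 - b₂))) :
    (1 - t₁ * t₂) ^ 2 ≤ (1 - a₁ * a₂) * (1 - b₁ * b₂) * (Φ₁ * Φ₂) := by
  have hP₁ : 1 ≤ Φ₁ := one_le_Phi hΦ₁ h2₁ h3₁ h4₁ h5₁
  have hP₂ : 1 ≤ Φ₂ := one_le_Phi hΦ₂ h2₂ h3₂ h4₂ h5₂
  -- degenerate `t`'s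
  rcases eq_or_lt_of_le ht₁ with h0 | ht₁pos
  · subst h0
    have h : 1 ≤ Φ₁ * ((1 - a₁) * (1 - b₁)) := by simpa using h1₁
    simpa using r6_zero ha₁ ha₂' hb₁ hb₂' ha₁' hb₁' hΦ₁ hP₂ h
  rcases eq_or_lt_of_le ht₂ with h0 | ht₂pos
  · subst h0
    have h : 1 ≤ Φ₂ * ((1 - a₂) * (1 - b₂)) := by simpa using h1₂
    have key := r6_zero ha₂ ha₁' hb₂ hb₁' ha₂' hb₂' hΦ₂ hP₁ h
    have e : (1 - a₂ * a₁) * (1 - b₂ * b₁) * (Φ₂ * Φ₁) = (1 - a₁ * a₂) * (1 - b₁ * b₂) * (Φ₁ * Φ₂) := by ring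
    simpa [e] using key
  rcases eq_or_lt_of_le ht₁' with h1 | ht₁lt
  · subst h1
    simpa using r6_one ha₁' ha₂ hb₁' hb₂ ha₂' hb₂' hP₁ hΦ₂ h1₂
  rcases eq_or_lt_of_le ht₂' with h1 | ht₂lt
  · subst h1
    have key := r6_one ha₂' ha₁ hb₂' hb₁ ha₁' hb₁' hP₂ hΦ₁ h1₁
    have e : (1 - a₂ * a₁) * (1 - b₂ * b₁) * (Φ₂ * Φ₁) = (1 - a₁ * a₂) * (1 - b₁ * b₂) * (Φ₁ * Φ₂) := by ring
    rw [e] at key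
    simpa using key
  -- main case: `a_i, b_i ∈ (0,1)` are forced
  have ha₁pos : 0 < a₁ := by
    rcases eq_or_lt_of_le ha₁ with h | h
    · subst h; nlinarith
    · exact h
  have hb₁pos : 0 < b₁ := by
    rcases eq_or_lt_of_le hb₁ with h | h
    · subst h; nlinarith
    · exact h
  have ha₂pos : 0 < a₂ := by
    rcases eq_or_lt_of_le ha₂ with h | h
    · subst h; nlinarith
    · exact h
  have hb₂pos : 0 < b₂ := by
    rcases eq_or_lt_of_le hb₂ with h | h
    · subst h; nlinarith
    · exact h
  have ha₁lt : a₁ < 1 := by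
    rcases eq_or_lt_of_le ha₁' with h | h
    · subst h; nlinarith
    · exact h
  have hb₁lt : b₁ < 1 := by
    rcases eq_or_lt_of_le hb₁' with h | h
    · subst h; nlinarith
    · exact h
  have ha₂lt : a₂ < 1 := by
    rcases eq_or_lt_of_le ha₂' with h | h
    · subst h; nlinarith
    · exact h
  have hb₂lt : b₂ < 1 := by
    rcases eq_or_lt_of_le hb₂' with h | h
    · subst h; nlinarith
    · exact h
  exact r6_main ht₁pos ht₁lt ha₁pos ha₁lt hb₁pos hb₁lt (by linarith) h1₁ h2₁ h3₁ h4₁ h5₁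
    ht₂pos ht₂lt ha₂pos ha₂lt hb₂pos hb₂lt (by linarith) h1₂ h2₂ h3₂ h4₂ h5₂

end Summit.CriticalPhenomena.PercolationContinuityZ3.Theorems.SuperTerminalQuarticR6
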